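import Summits.HodgeConjecture.CorCM.MultiFieldWeilEqualPrimes
import HarnessLib

/-!
# MULTI-FIELD WEIL ENGINE — THE STABILISER-TRANSITIVE TRANSFER: the signed equations at the realised tuples imply the signed equations at EVERY tuple of the
# product of the slot images, as soon as the tuples trivial at each slot are transitive on every other slot; hence the defect law WITHOUT a tower

Cell `pub-hodgecm2` (COR-CM), seat b30 gen 35 (2026-08-25); count-neutral own lane MULTI-FIELD WEIL ENGINE (stem `MultiFieldWeil*`), census level (the finite model of
`Census/MultiFieldWeil*`, abstract tuple sets `R ⊆ ∏_m Sym(n_m)`), sequel of `CorCM/MultiFieldWeilPrimeTower.lean` ∕ `CorCM/MultiFieldWeilEqualPrimes.lean`.  Theorems only;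
no definition, no named fact, no `sorry`, no `decide`.  HONEST FRAMING: pure finite combinatorics; `HC_CM` is NOT touched.

THE POINT.  The prime tower (gens 29–30) peels the slots of a family `E, T_1, …, T_r` one by one with tuples of `R` (the realised tuples of `Aut(ℂ/τk)`) that MOVE one slot
and FIX all its predecessors — a TOWER hypothesis on the fields (each `K_m` outside the compositum of the Galois closures of `K_0, …, K_{m−1}`), violated e.g. by the pure
cubic triple `k(∛a), k(∛b), k(∛(ab))`, `k = ℚ(√−3)`.  This file shows that the tower is not needed: the signed equations (`Census/MultiFieldWeil.signed_of_modelBalancedG`)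
at the tuples of `R` IMPLY the signed equations at every tuple of the PRODUCT `R⁺ = ∏_m G_m` of the slot images (§3, **`signed_transfer`**), provided `R` is
STABILISER-TRANSITIVE: for all slots `m₀ ≠ m` the tuples of `R` that are the identity at `m₀` act transitively on the positions of `m` (for realised tuples of sextic fields
`K_m ∋ k`: `K_m ⊄` the Galois closure of `K_{m₀}`, i.e. `K_m ≇ K_{m₀}` — the sequel).  Since `R⁺` contains, for every slot, a tuple moving that slot alone, the prime tower
applies to `R⁺` with the EMPTY set of predecessors, and (§4, **`exists_hasDefectsG_of_stabiliserTransitive`**) every configuration balanced under `R` obeys the DEFECT LAW —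
for slots of prime sizes with proper non-empty position sets, nothing else assumed.  PROOF of §3 (averaging): summing the signed equations `u + Σ_m E_m(π_m) = 0` over the
coset `{π ∈ R : π_{m₀} = σ}` — uniform on every other slot by stabiliser-transitivity (§1), so that `Σ_{coset} E_m(π_m) = |coset| · A_m` with `A_m = (2|P_m| − n_m) D_m / n_m`,
`D_m = Σ_a d_m(a)` (§2) — gives `u + E_{m₀}(σ) + Σ_{m ≠ m₀} A_m = 0`; summing over all of `R` gives `u + Σ_m A_m = 0`; hence `u + Σ_m E_m(σ_m) = 0` for every `(σ_m) ∈ R⁺`.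
(Representation-theoretically: balancedness only sees the span of the `R`-translates of the type vector, and that span is the same for `R` and `R⁺`.)

[cite: MoonenZarhin1995Duke, Thm. 2.4] [cite: Pohlmann1968, Thm 1] [cite: GaoUllmo2025, Thm 3.1] [cite: DixonMortimer1996, §1.6 and Thm. 1.6A]

## References
* [MoonenZarhin1995Duke] B. Moonen, Yu. Zarhin, Duke Math. J. 77 (1995), Thm. 2.4.  [Pohlmann1968] H. Pohlmann, Ann. of Math. 88 (1968), Thm 1.  [GaoUllmo2025] Z. Gao, E. Ullmo,
  J. Inst. Math. Jussieu 25 (2025), Thm 3.1.  [DixonMortimer1996] J. D. Dixon, B. Mortimer, *Permutation Groups*, GTM 163, §1.6, Thm. 1.6A.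
-/

noncomputable section

namespace Summit.HodgeConjecture.CorCM.MultiFieldWeil

open Finset
open Summit.HodgeConjecture.CorCM.Census.MultiFieldWeil

open scoped Classical

section Model

variable {r : ℕ} {n : Fin r → ℕ} {R : Finset (PermsG n)} {P : ∀ m : Fin r, Finset (Fin (n m))}

/-! ## §1 Uniform families of tuples: counting under a right mover -/

/-- **Right movers transport the fibre counts**: if `C · ν ⊆ C` and `ν_m a' = a` then `#{π ∈ C | π_m a ∈ Q} ≤ #{π ∈ C | π_m a' ∈ Q}` (`π ↦ π ν` is injective and maps
the first set into the second). [folklore] -/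
theorem card_filter_apply_mem_le_of_mul_mem (C : Finset (PermsG n)) {ν : PermsG n} (hν : ∀ π ∈ C, π * ν ∈ C) {m : Fin r} (Q : Finset (Fin (n m)))
    {a a' : Fin (n m)} (ha : ν m a' = a) : (C.filter fun π => π m a ∈ Q).card ≤ (C.filter fun π => π m a' ∈ Q).card := by
  refine Finset.card_le_card_of_injOn (fun π => π * ν) (fun π hπ => ?_) (fun π₁ _ π₂ _ h => mul_right_cancel h)
  rw [Finset.mem_coe, Finset.mem_filter] at hπ ⊢
  refine ⟨hν π hπ.1, ?_⟩
  show (π * ν) m a' ∈ Q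
  rw [Pi.mul_apply, Equiv.Perm.mul_apply, ha]
  exact hπ.2

/-- **A family of tuples admitting right movers between any two positions of the slot `m` is UNIFORM on that slot**: `#{π ∈ C | π_m a ∈ Q}` does not depend on `a`.
[folklore] -/
theorem card_filter_apply_mem_eq_of_movers (C : Finset (PermsG n)) {m : Fin r}
    (hmov : ∀ a a' : Fin (n m), ∃ ν : PermsG n, (∀ π ∈ C, π * ν ∈ C) ∧ ν m a' = a) (Q : Finset (Fin (n m))) (a a' : Fin (n m)) :
    (C.filter fun π => π m a ∈ Q).card = (C.filter fun π => π m a' ∈ Q).card := by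
  apply le_antisymm
  · obtain ⟨ν, hν, hνa⟩ := hmov a a'
    exact card_filter_apply_mem_le_of_mul_mem C hν Q hνa
  · obtain ⟨ν, hν, hνa⟩ := hmov a' a
    exact card_filter_apply_mem_le_of_mul_mem C hν Q hνa

/-! ## §2 The signed slot sum of a uniform family -/

/-- `Σ_{π ∈ C} (if p π then x else −x) = (2 · #{π ∈ C | p π} − |C|) · x`. [folklore] -/
theorem sum_ite_const_neg (C : Finset (PermsG n)) (p : PermsG n → Prop) [DecidablePred p] (x : ℤ) :
    (∑ π ∈ C, (if p π then x else -x)) = (2 * ((C.filter p).card : ℤ) - C.card) * x := by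
  rw [Finset.sum_ite, Finset.sum_const, Finset.sum_const, ← Finset.card_filter_add_card_filter_not (s := C) p]
  push_cast
  ring

/-- **The signed slot sum of a UNIFORM family**: if `#{π ∈ C | π_m a ∈ P_m}` does not depend on `a`, then
`n_m · Σ_{π ∈ C} Σ_a (±_{π_m a ∈ P_m} d a) = |C| · (2|P_m| − n_m) · Σ_a d a`. [cite: MoonenZarhin1995Duke, Thm. 2.4] -/
theorem sum_signed_slot_of_uniform (C : Finset (PermsG n)) (m : Fin r) (d : Fin (n m) → ℤ)
    (hunif : ∀ a a' : Fin (n m), (C.filter fun π => π m a ∈ P m).card = (C.filter fun π => π m a' ∈ P m).card) :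
    (n m : ℤ) * ∑ π ∈ C, ∑ a : Fin (n m), (if π m a ∈ P m then d a else -d a) =
      (C.card : ℤ) * (2 * ((P m).card : ℤ) - n m) * ∑ a : Fin (n m), d a := by
  rcases Nat.eq_zero_or_pos (n m) with h0 | hpos
  · -- no positions: both sides vanish
    have he : (Finset.univ : Finset (Fin (n m))) = ∅ := Finset.univ_eq_empty_iff.2 (by rw [← Fintype.card_eq_zero_iff, Fintype.card_fin]; exact h0)
    simp [he, h0]
  · obtain ⟨a₀⟩ : Nonempty (Fin (n m)) := ⟨⟨0, hpos⟩⟩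
    set K : ℤ := ((C.filter fun π => π m a₀ ∈ P m).card : ℤ) with hK
    -- every position has the same count `K`
    have hKa : ∀ a : Fin (n m), ((C.filter fun π => π m a ∈ P m).card : ℤ) = K := fun a => by rw [hK, hunif a a₀]
    -- `n_m · K = |C| · |P_m|` (double counting)
    have hdouble : (n m : ℤ) * K = (C.card : ℤ) * (P m).card := by
      have h1 : ∑ a : Fin (n m), ((C.filter fun π => π m a ∈ P m).card : ℤ) = (n m : ℤ) * K := by
        rw [Finset.sum_congr rfl fun a _ => hKa a, Finset.sum_const, Finset.card_univ, Fintype.card_fin]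
        simp
      have h2 : ∑ a : Fin (n m), ((C.filter fun π => π m a ∈ P m).card : ℤ) = ∑ π ∈ C, ((Finset.univ.filter fun a : Fin (n m) => π m a ∈ P m).card : ℤ) := by
        simp only [Finset.card_filter]
        push_cast
        rw [Finset.sum_comm]
      have h3 : ∑ π ∈ C, ((Finset.univ.filter fun a : Fin (n m) => π m a ∈ P m).card : ℤ) = (C.card : ℤ) * (P m).card := by
        rw [Finset.sum_congr rfl fun π _ => by rw [card_filter_perm_mem (π m) (P m)], Finset.sum_const]
        simp
      rw [← h1, h2, h3]
    -- the signed sum, position by position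
    have hswap : (∑ π ∈ C, ∑ a : Fin (n m), (if π m a ∈ P m then d a else -d a)) =
        ∑ a : Fin (n m), (2 * K - C.card) * d a := by
      rw [Finset.sum_comm]
      refine Finset.sum_congr rfl fun a _ => ?_
      rw [sum_ite_const_neg C (fun π => π m a ∈ P m) (d a), hKa a]
    rw [hswap, ← Finset.mul_sum]
    have : (n m : ℤ) * ((2 * K - C.card) * ∑ a : Fin (n m), d a) = (2 * ((n m : ℤ) * K) - (n m : ℤ) * C.card) * ∑ a : Fin (n m), d a := by ring
    rw [this, hdouble]
    ring

/-- **The signed slot sum of a uniform family, divided**: `Σ_{π ∈ C} E_m(π_m) = |C| · A_m` in `ℚ`, `A_m = (2|P_m| − n_m) · (Σ_a d a) / n_m` (both sides vanish for an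
empty slot). [cite: MoonenZarhin1995Duke, Thm. 2.4] -/
theorem sum_signed_slot_eq_card_mul (C : Finset (PermsG n)) (m : Fin r) (d : Fin (n m) → ℤ)
    (hunif : ∀ a a' : Fin (n m), (C.filter fun π => π m a ∈ P m).card = (C.filter fun π => π m a' ∈ P m).card) :
    (∑ π ∈ C, ((∑ a : Fin (n m), (if π m a ∈ P m then d a else -d a) : ℤ) : ℚ)) =
      (C.card : ℚ) * ((2 * ((P m).card : ℚ) - n m) * (∑ a : Fin (n m), (d a : ℚ)) / n m) := by
  rcases Nat.eq_zero_or_pos (n m) with h0 | hpos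
  · have he : (Finset.univ : Finset (Fin (n m))) = ∅ := Finset.univ_eq_empty_iff.2 (by rw [← Fintype.card_eq_zero_iff, Fintype.card_fin]; exact h0)
    simp [he, h0]
  · have hz := sum_signed_slot_of_uniform C m d hunif
    have hn : (n m : ℚ) ≠ 0 := by exact_mod_cast hpos.ne'
    rw [eq_comm, mul_div_assoc', div_eq_iff hn]  -- goal: |C| * ((2|P| - n) * D) = (Σ E) * n
    have hz' : ((n m : ℤ) : ℚ) * ((∑ π ∈ C, ∑ a : Fin (n m), (if π m a ∈ P m then d a else -d a) : ℤ) : ℚ) =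
        ((C.card : ℤ) : ℚ) * (2 * ((P m).card : ℤ) - n m : ℤ) * ((∑ a : Fin (n m), d a : ℤ) : ℚ) := by exact_mod_cast hz
    push_cast at hz' ⊢
    rw [Finset.sum_comm] at hz' ⊢  -- harmless normalisation attempt
    linarith [hz']

/-! ## §3 The transfer -/

/-- **THE STABILISER-TRANSITIVE TRANSFER.**  `R ⊆ ∏_m Sym(n_m)` non-empty, product-closed, transitive on every slot, and STABILISER-TRANSITIVE: for `m₀ ≠ m` and positions
`a, a'` of `m` some tuple of `R` is the identity at `m₀` and carries `a` to `a'` at `m`.  If the signed equations `u + Σ_m Σ_a (±_{π_m a ∈ P_m} d_m a) = 0` hold at every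
`π ∈ R`, they hold at every tuple `π'` all of whose components are components of tuples of `R` (the product of the slot images).
[cite: MoonenZarhin1995Duke, Thm. 2.4] [cite: GaoUllmo2025, Thm 3.1] -/
theorem signed_transfer (hmul : ∀ π ∈ R, ∀ π' ∈ R, π * π' ∈ R) (hne : R.Nonempty) (htrans : ∀ (m : Fin r) (a a' : Fin (n m)), ∃ π ∈ R, π m a = a')
    (hstab : ∀ (m₀ m : Fin r), m₀ ≠ m → ∀ a a' : Fin (n m), ∃ ν ∈ R, ν m₀ = 1 ∧ ν m a = a')
    {u : ℤ} {d : ∀ m : Fin r, Fin (n m) → ℤ}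
    (h : ∀ π ∈ R, u + ∑ m : Fin r, ∑ a : Fin (n m), (if π m a ∈ P m then d m a else -d m a) = 0)
    (π' : PermsG n) (hπ' : ∀ m, ∃ π ∈ R, π m = π' m) :
    u + ∑ m : Fin r, ∑ a : Fin (n m), (if π' m a ∈ P m then d m a else -d m a) = 0 := by
  -- notation: the signed slot sums and their averages
  set E : ∀ m : Fin r, Equiv.Perm (Fin (n m)) → ℤ := fun m σ => ∑ a : Fin (n m), (if σ a ∈ P m then d m a else -d m a) with hE
  set A : Fin r → ℚ := fun m => (2 * ((P m).card : ℚ) - n m) * (∑ a : Fin (n m), (d m a : ℚ)) / n m with hA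
  have hEdef : ∀ (m : Fin r) (σ : Equiv.Perm (Fin (n m))), E m σ = ∑ a : Fin (n m), (if σ a ∈ P m then d m a else -d m a) := fun _ _ => rfl
  -- (1) over all of `R`: `Σ_{π ∈ R} E_m(π_m) = |R| A_m`, hence `u + Σ_m A_m = 0`
  have hunifR : ∀ (m : Fin r) (a a' : Fin (n m)), (R.filter fun π => π m a ∈ P m).card = (R.filter fun π => π m a' ∈ P m).card := fun m =>
    card_filter_apply_mem_eq_of_movers R (fun a a' => by
      obtain ⟨ν, hν, hνa⟩ := htrans m a' a
      exact ⟨ν, fun π hπ => hmul π hπ ν hν, hνa⟩) (P m)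
  have hsumR : ∀ m : Fin r, (∑ π ∈ R, (E m (π m) : ℚ)) = (R.card : ℚ) * A m := fun m => by
    simp only [hEdef, hA]
    exact sum_signed_slot_eq_card_mul R m (d m) (hunifR m)
  have hRpos : (0 : ℚ) < R.card := by exact_mod_cast Finset.card_pos.2 hne
  have hstar : (u : ℚ) + ∑ m : Fin r, A m = 0 := by
    have h1 : ∑ π ∈ R, ((u : ℚ) + ∑ m : Fin r, (E m (π m) : ℚ)) = 0 := by
      refine Finset.sum_eq_zero fun π hπ => ?_
      have := h π hπ
      simp only [← hEdef] at this
      exact_mod_cast this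
    rw [Finset.sum_add_distrib, Finset.sum_const, Finset.sum_comm, Finset.sum_congr rfl fun m _ => hsumR m, ← Finset.mul_sum, nsmul_eq_mul,
      ← mul_add] at h1
    exact (mul_eq_zero.1 h1).resolve_left hRpos.ne'
  -- (2) over the coset `{π ∈ R | π_{m₀} = π'_{m₀}}`: `E_{m₀}(π'_{m₀}) = A_{m₀}`
  have hslot : ∀ m₀ : Fin r, (E m₀ (π' m₀) : ℚ) = A m₀ := by
    intro m₀
    set C : Finset (PermsG n) := R.filter fun π => π m₀ = π' m₀ with hC
    have hCR : C ⊆ R := Finset.filter_subset _ _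
    have hCne : C.Nonempty := by
      obtain ⟨π, hπ, hπm⟩ := hπ' m₀
      exact ⟨π, Finset.mem_filter.2 ⟨hπ, hπm⟩⟩
    have hCpos : (0 : ℚ) < C.card := by exact_mod_cast Finset.card_pos.2 hCne
    -- uniform on every other slot (movers trivial at `m₀` preserve the coset)
    have hunifC : ∀ m : Fin r, m ≠ m₀ → ∀ a a' : Fin (n m), (C.filter fun π => π m a ∈ P m).card = (C.filter fun π => π m a' ∈ P m).card :=
      fun m hm => card_filter_apply_mem_eq_of_movers C (fun a a' => by
        obtain ⟨ν, hν, hν₀, hνa⟩ := hstab m₀ m (Ne.symm hm) a' a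
        refine ⟨ν, fun π hπ => ?_, hνa⟩
        rw [hC, Finset.mem_filter] at hπ ⊢
        exact ⟨hmul π hπ.1 ν hν, by rw [Pi.mul_apply, hν₀, mul_one, hπ.2]⟩) (P m)
    have hsumC : ∀ m : Fin r, m ≠ m₀ → (∑ π ∈ C, (E m (π m) : ℚ)) = (C.card : ℚ) * A m := fun m hm => by
      simp only [hEdef, hA]
      exact sum_signed_slot_eq_card_mul C m (d m) (hunifC m hm)
    have hsumC₀ : (∑ π ∈ C, (E m₀ (π m₀) : ℚ)) = (C.card : ℚ) * E m₀ (π' m₀) := by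
      rw [Finset.sum_congr rfl fun π hπ => by rw [(Finset.mem_filter.1 hπ).2], Finset.sum_const, nsmul_eq_mul]
    -- sum the signed equations over the coset
    have h1 : ∑ π ∈ C, ((u : ℚ) + ∑ m : Fin r, (E m (π m) : ℚ)) = 0 := by
      refine Finset.sum_eq_zero fun π hπ => ?_
      have := h π (hCR hπ)
      simp only [← hEdef] at this
      exact_mod_cast this
    have h2 : ∑ m : Fin r, ∑ π ∈ C, (E m (π m) : ℚ) = (C.card : ℚ) * ((E m₀ (π' m₀) : ℚ) - A m₀ + ∑ m : Fin r, A m) := by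
      have h3 : ∀ m : Fin r, (∑ π ∈ C, (E m (π m) : ℚ)) = (C.card : ℚ) * A m + (if m = m₀ then (C.card : ℚ) * ((E m₀ (π' m₀) : ℚ) - A m₀) else 0) := by
        intro m
        by_cases hm : m = m₀
        · subst hm
          rw [if_pos rfl, hsumC₀]
          ring
        · rw [if_neg hm, hsumC m hm, add_zero]
      rw [Finset.sum_congr rfl fun m _ => h3 m, Finset.sum_add_distrib, Finset.sum_ite_eq' Finset.univ m₀, if_pos (Finset.mem_univ _), ← Finset.mul_sum]
      ring
    rw [Finset.sum_add_distrib, Finset.sum_const, nsmul_eq_mul, Finset.sum_comm, h2, ← mul_add] at h1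
    have h4 : (u : ℚ) + ((E m₀ (π' m₀) : ℚ) - A m₀ + ∑ m : Fin r, A m) = 0 := (mul_eq_zero.1 h1).resolve_left hCpos.ne'
    linarith [hstar, h4]
  -- (3) conclude
  have hfin : (u : ℚ) + ∑ m : Fin r, (E m (π' m) : ℚ) = 0 := by
    rw [Finset.sum_congr rfl fun m _ => hslot m]
    exact hstar
  have : ((u + ∑ m : Fin r, E m (π' m) : ℤ) : ℚ) = 0 := by push_cast; exact hfin
  exact_mod_cast this

/-! ## §4 The defect law from stabiliser-transitivity (abstract tuple sets) -/

/-- **THE DEFECT LAW WITHOUT A TOWER.**  `R ⊆ ∏_m Sym(n_m)` non-empty, closed under products and inverses, transitive on every slot and STABILISER-TRANSITIVE; all slots of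
PRIME size with proper non-empty position sets (`0 < |P_m| < n_m`, curve multiplicities `c_m = n_m − 2|P_m|`).  Then every configuration balanced under `R` obeys the
defect law.  (The signed equations transfer to the product of the slot images, §3; there every slot is moved alone by a tuple of prime order —
`exists_orderOf_eq_of_trivial_on` — so the prime tower `const_of_signed_primeTower` runs with NO predecessors; `exists_defects_of_const` assembles.)
[cite: MoonenZarhin1995Duke, Thm. 2.4] [cite: DixonMortimer1996, §1.6 and Thm. 1.6A] [cite: GaoUllmo2025, Thm 3.1] -/
theorem exists_hasDefectsG_of_stabiliserTransitive (hmul : ∀ π ∈ R, ∀ π' ∈ R, π * π' ∈ R) (hinv : ∀ π ∈ R, π⁻¹ ∈ R) (hne : R.Nonempty)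
    (htrans : ∀ (m : Fin r) (a a' : Fin (n m)), ∃ π ∈ R, π m a = a')
    (hstab : ∀ (m₀ m : Fin r), m₀ ≠ m → ∀ a a' : Fin (n m), ∃ ν ∈ R, ν m₀ = 1 ∧ ν m a = a')
    (hpr : ∀ m, (n m).Prime) (hP0 : ∀ m, (P m).Nonempty) (hPn : ∀ m, (P m).card < n m)
    (c : Fin r → ℕ) (hc : ∀ m, ((c m : ℕ) : ℤ) = (n m : ℤ) - 2 * (P m).card)
    {α : Type} (v : α → PtG n) (T : Finset α) (hT : ModelBalancedG P R v T) : ∃ t : Fin r → ℤ, HasDefectsG c v T t := by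
  have h1R : (1 : PermsG n) ∈ R := one_mem_of_closed hmul hinv hne
  -- the product of the slot images
  set R' : Finset (PermsG n) := Finset.univ.filter fun π' => ∀ m, ∃ π ∈ R, π m = π' m with hR'
  have hmemR' : ∀ π' : PermsG n, π' ∈ R' ↔ ∀ m, ∃ π ∈ R, π m = π' m := fun π' => by simp [hR']
  have hRR' : R ⊆ R' := fun π hπ => (hmemR' π).2 fun m => ⟨π, hπ, rfl⟩
  have hmul' : ∀ π ∈ R', ∀ π' ∈ R', π * π' ∈ R' := by
    intro π₁ h₁ π₂ h₂
    rw [hmemR'] at h₁ h₂ ⊢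
    intro m
    obtain ⟨ρ₁, hρ₁, e₁⟩ := h₁ m
    obtain ⟨ρ₂, hρ₂, e₂⟩ := h₂ m
    exact ⟨ρ₁ * ρ₂, hmul _ hρ₁ _ hρ₂, by rw [Pi.mul_apply, Pi.mul_apply, e₁, e₂]⟩
  have hinv' : ∀ π ∈ R', π⁻¹ ∈ R' := by
    intro π₁ h₁
    rw [hmemR'] at h₁ ⊢
    intro m
    obtain ⟨ρ, hρ, e⟩ := h₁ m
    exact ⟨ρ⁻¹, hinv _ hρ, by rw [Pi.inv_apply, Pi.inv_apply, e]⟩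
  have hne' : R'.Nonempty := hne.mono hRR'
  have htrans' : ∀ (m : Fin r) (a a' : Fin (n m)), ∃ π ∈ R', π m a = a' := fun m a a' => by
    obtain ⟨π, hπ, h⟩ := htrans m a a'
    exact ⟨π, hRR' hπ, h⟩
  -- the signed equations at `R`, transferred to `R'`
  have hsig : ∀ π ∈ R', (((cnt v T (Sum.inl true)) : ℤ) - cnt v T (Sum.inl false)) +
      ∑ m : Fin r, ∑ a : Fin (n m), (if π m a ∈ P m then ((cnt v T (Sum.inr ⟨m, (a, true)⟩) : ℤ) - cnt v T (Sum.inr ⟨m, (a, false)⟩))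
        else -(((cnt v T (Sum.inr ⟨m, (a, true)⟩)) : ℤ) - cnt v T (Sum.inr ⟨m, (a, false)⟩))) = 0 := fun π' hπ' =>
    signed_transfer (d := fun m a => ((cnt v T (Sum.inr ⟨m, (a, true)⟩)) : ℤ) - cnt v T (Sum.inr ⟨m, (a, false)⟩)) hmul hne htrans hstab
      (fun π hπ => signed_of_modelBalancedG R v hT hπ) π' ((hmemR' π').1 hπ')
  -- every slot is moved ALONE, inside `R'`, by a tuple of prime order
  have hpure : ∀ m₀ : Fin r, m₀ ∉ (∅ : Finset (Fin r)) → ∃ ρ ∈ R', (∀ m ∈ (∅ : Finset (Fin r)), ρ m = 1) ∧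
      (∀ m, m ∉ (∅ : Finset (Fin r)) → (m : ℕ) < (m₀ : ℕ) → ρ m = 1) ∧ orderOf (ρ m₀) = n m₀ := by
    intro m₀ _
    -- a tuple of `R'` trivial off `m₀` and non-trivial at `m₀`
    have h2 : 2 ≤ n m₀ := (hpr m₀).two_le
    obtain ⟨π₁, hπ₁, hmove⟩ := htrans m₀ ⟨0, by omega⟩ ⟨1, by omega⟩
    have hσ : π₁ m₀ ≠ 1 := fun h => by
      have := hmove
      rw [h, Equiv.Perm.one_apply] at this
      exact absurd (congrArg Fin.val this) (by simp)
    have hex : ∃ π ∈ R', (∀ m ∈ Finset.univ.erase m₀, π m = 1) ∧ π m₀ ≠ 1 := by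
      refine ⟨Function.update (1 : PermsG n) m₀ (π₁ m₀), (hmemR' _).2 fun m => ?_, fun m hm => ?_, ?_⟩
      · by_cases hm : m = m₀
        · subst hm
          exact ⟨π₁, hπ₁, by rw [Function.update_self]⟩
        · exact ⟨1, h1R, by rw [Function.update_of_ne hm, Pi.one_apply]⟩
      · rw [Function.update_of_ne (Finset.ne_of_mem_erase hm), Pi.one_apply]
      · rw [Function.update_self]
        exact hσ
    obtain ⟨ρ, hρ, hρS, hord⟩ := exists_orderOf_eq_of_trivial_on hmul' hinv' hne' (hpr m₀) (htrans' m₀) (Finset.univ.erase m₀) hex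
    exact ⟨ρ, hρ, fun m hm => absurd hm (Finset.notMem_empty m), fun m _ hlt => hρS m (Finset.mem_erase.2 ⟨fun h => by rw [h] at hlt; exact lt_irrefl _ hlt,
      Finset.mem_univ m⟩), hord⟩
  -- the prime tower with no predecessors: all defects are constant
  have hconst := const_of_signed_primeTower (P := P) hmul' hne' ∅ (fun m => (m : ℕ)) (fun m _ => hpr m) (fun m m' _ _ h => Fin.ext h) (fun m _ => hP0 m)
    (fun m _ => hPn m) hpure hsig
  obtain ⟨t, hd, he⟩ := exists_defects_of_const (P := P) hne' (fun m a b => hconst m (Finset.notMem_empty m) a b) hsig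
  refine ⟨t, fun m a => hd m a, ?_⟩
  rw [he]
  exact Finset.sum_congr rfl fun m _ => by rw [hc m]

end Model

/-! ## §5 Realised tuples -/

section Realised

variable {I : Type} {r : ℕ} {Kf : I → Type} [∀ i, Field (Kf i)] [∀ i, NumberField (Kf i)] {i₀ : I} {is : Fin r → I} {n : Fin r → ℕ}
  {e : ∀ m : Fin r, (Kf (is m) →+* ℂ) ≃ Fin (n m) × Bool} {τ : Kf i₀ →+* ℂ} {im : ∀ m : Fin r, Kf i₀ →+* Kf (is m)}
  (he_sign : ∀ (m : Fin r) (s : Kf (is m) →+* ℂ), (e m s).2 = true ↔ s.comp (im m) = τ)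

include he_sign in
/-- **THE DEFECT LAW FOR STABILISER-TRANSITIVE REALISED TUPLES.**  Frames `e_m` on CM fields `K_m ⊇ i_m(k)` of PRIME relative degrees `n_m`, position sets
`0 < |P_m| < n_m`; if for all slots `m₀ ≠ m` and positions `a, a'` of `m` some realised tuple is the identity at `m₀` and carries `a` to `a'` at `m` (for sextic fields through
`k`: `K_m ≇ K_{m₀}`, the sequel), then every configuration balanced under the realised tuples obeys the defect law — NO tower, NO ordering.
[cite: MoonenZarhin1995Duke, Thm. 2.4] [cite: Shimura1998, §18.2 Lemma (i)] [cite: DixonMortimer1996, §1.6 and Thm. 1.6A] -/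
theorem exists_hasDefectsG_realisedTuples_of_stabiliserTransitive (hpr : ∀ m, (n m).Prime)
    (hstab : ∀ (m₀ m : Fin r), m₀ ≠ m → ∀ a a' : Fin (n m), ∃ ν ∈ realisedTuples e τ, ν m₀ = 1 ∧ ν m a = a')
    {P : ∀ m : Fin r, Finset (Fin (n m))} (hP0 : ∀ m, (P m).Nonempty) (hPn : ∀ m, (P m).card < n m)
    (c : Fin r → ℕ) (hc : ∀ m, ((c m : ℕ) : ℤ) = (n m : ℤ) - 2 * (P m).card)
    {α : Type} (v : α → PtG n) (T : Finset α) (hT : ModelBalancedG P (realisedTuples e τ) v T) : ∃ t : Fin r → ℤ, HasDefectsG c v T t :=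
  exists_hasDefectsG_of_stabiliserTransitive (fun _ hπ _ hπ' => mul_mem_realisedTuples e τ hπ hπ') (fun _ hπ => inv_mem_realisedTuples hπ)
    (realisedTuples_nonempty (e := e) he_sign) (fun m a b => transitive_realisedTuples (e := e) he_sign m a b) hstab hpr hP0 hPn c hc v T hT

end Realised

end Summit.HodgeConjecture.CorCM.MultiFieldWeil

end
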